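import Summits.NavierStokesRegularity.FunctionalMining.StretchingLowerCellularIntegrals
import Summits.NavierStokesRegularity.FunctionalMining.StretchingClassConst
import HarnessLib

/-!
# K1-Q1 lower side in the kernel: `½ ≤ C⋆`, and the 2½-D stretching constant is exactly `½`

Cell `pub-nsfunc` (host summit NavierStokesRegularity, topic `FunctionalMining`), prove seat gen 5 — kernel version of
the bank seat's hand Theorem 1 (`pub-nsfunc-bank/K1Q1-HALF.md`). **Search for candidate a priori estimates; no regularity claim.** Static field facts only; nothing is
asserted about Navier–Stokes solutions or their regularity.

Along the cellular family `u_{ε,m}` (parts 1–4) with the balanced amplitude `a_m = √2·m/(m + L)`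
(`a_m + L·a_m/m = √2`, so `|∇w| ≤ 2 = sup|ζ|` and `‖ω‖∞ = 2` exactly): if `σ(u_{ε,m}) ≤ C·2·ℰ(u_{ε,m})` then
`4a_m²(ι² − 4ε) − K_m ≤ C(2 + 4a_m²ι² + K_m)`; `m → ∞` (`a_m² → 2`, `K_m → 0`) gives `8ι² − 32ε ≤ C(2 + 8ι²)`,
and `ι ≥ ½ − 6ε`, `ε → 0` force `C ≥ ½`. Results:
* `not_stretchingSupBound_of_lt_half`: `¬ StretchingSupBound C` for every `C < ½`;
* **`half_le_stretchingSupConst : ½ ≤ stretchingSupConst (d := Fin 3)`** — the K1-Q1 kernel window becomes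
  `½ ≤ C⋆ ≤ 2/√3` (ratio `4/√3 ≈ 2.31`; previously `√(71−17√17)/4 ≈ 0.238 ≤ C⋆`);
* `not_stretchingSupBoundPlanar_of_lt_half` and **`stretchingSupBoundPlanar_iff : StretchingSupBoundPlanar C ↔ ½ ≤ C`**
  (with the dictionary seat's upper bound `stretchingSupBoundPlanar_half`): the 2½-D class constant is EXACTLY `½`,
  also as `stretchingSupConstOn_isTwoHalfD_eq_half : stretchingSupConstOn IsTwoHalfD = ½` (class-constant vocabulary);
Whether genuinely three-dimensional fields exceed `½` is open at kernel level (the bank's hand Theorem 3: `(2+√5)/8`).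
-/

noncomputable section

open MeasureTheory Set Filter Topology Function
open scoped InnerProductSpace ContDiff

namespace Summit.NavierStokesRegularity.FunctionalMining

open Literature.Analysis Literature.Analysis.FunctionSpaces Literature.Analysis.FunctionSpaces.Torus
open Literature.Analysis.FluidPDE Literature.Analysis.FluidPDE.Torus

namespace CellularStretching

/-! ## 10. Scalars, the kill inequality, the limits `m → ∞`, `ε → 0`: `½ ≤ C⋆` -/

section Kill

variable {ε : ℝ} (hε : 0 < ε) (hε' : ε ≤ 1 / 32)

include hε hε' in
/-- **`∫₀¹ S_ε'² = 1 − s ≤ 1`.** [folklore] -/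
theorem msqD_base_eq : msqD (base hε hε') = 1 - slack ε := by
  have hc : Continuous fun t => DEIJ.slopeWave ε t ^ 2 := (DEIJ.continuous_slopeWave hε (le_sixteenth hε')).pow 2
  rw [msqD, slack, deriv_base, intervalIntegral.integral_sub intervalIntegrable_const (hc.intervalIntegrable 0 1),
    intervalIntegral.integral_const]
  simp

include hε hε' in
/-- **`ι ≥ ½ − 6ε`**: the envelope equals `1` on `[1/4 + 4ε, 3/4 − 2ε]`. [ours; elementary] -/
theorem le_envMsq : 1 / 2 - 6 * ε ≤ envMsq (envM hε hε') := by
  unfold envMsq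
  have hcont : Continuous fun t => envM hε hε' t ^ 2 := (envM hε hε').continuous.pow 2
  have h1 : ∫ t in (4⁻¹ + 4 * ε)..(3 / 4 - 2 * ε), envM hε hε' t ^ 2 = 1 / 2 - 6 * ε := by
    have : ∫ t in (4⁻¹ + 4 * ε)..(3 / 4 - 2 * ε), envM hε hε' t ^ 2 =
        ∫ _t in (4⁻¹ + 4 * ε)..(3 / 4 - 2 * ε), (1 : ℝ) := by
      refine intervalIntegral.integral_congr fun t ht => ?_
      rw [uIcc_of_le (by linarith)] at ht
      have hf : Int.fract t = t := Int.fract_eq_self.2 ⟨by linarith [ht.1], by linarith [ht.2]⟩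
      rw [envM_eq_one hε hε' (by rw [hf]; exact ht.1) (by rw [hf]; exact ht.2)]; norm_num
    rw [this, intervalIntegral.integral_const, smul_eq_mul, mul_one]; ring
  have h2 : ∫ t in (4⁻¹ + 4 * ε)..(3 / 4 - 2 * ε), envM hε hε' t ^ 2 ≤ ∫ t in (0 : ℝ)..1, envM hε hε' t ^ 2 :=
    intervalIntegral.integral_mono_interval (by linarith) (by linarith) (by linarith)
      (Filter.Eventually.of_forall fun t => sq_nonneg _) (hcont.intervalIntegrable 0 1)
  linarith

/-- `0 ≤ ½ − 6ε` for admissible `ε`. [folklore] -/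
theorem half_sub_nonneg (hε' : ε ≤ 1 / 32) : 0 ≤ 1 / 2 - 6 * ε := by linarith

include hε hε' in
/-- `0 ≤ L`. [folklore] -/
theorem envLip_nonneg : 0 ≤ envLip ε :=
  (abs_nonneg _).trans (abs_deriv_envM_le hε hε' 0)

/-- `0 ≤ K`. [folklore] -/
theorem Kc_nonneg (hL : 0 ≤ envLip ε) (m : ℕ) (a : ℝ) : 0 ≤ Kc ε m a := by
  unfold Kc; positivity

/-- **The balanced amplitude** `a_m = √2·m/(m + L)`: then `a_m + L·a_m/m = √2`, so `|∇w| ≤ 2 = sup|ζ|`. [ours] -/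
def amp (L : ℝ) (m : ℕ) : ℝ := Real.sqrt 2 * m / (m + L)

/-- `0 < a_m`. [ours; elementary] -/
theorem amp_pos {L : ℝ} (hL : 0 ≤ L) {m : ℕ} (hm : 0 < m) : 0 < amp L m := by
  unfold amp
  have : (0 : ℝ) < m := Nat.cast_pos.2 hm
  positivity

/-- `a_m ≤ √2`. [ours; elementary] -/
theorem amp_le {L : ℝ} (hL : 0 ≤ L) (m : ℕ) : amp L m ≤ Real.sqrt 2 := by
  unfold amp
  rcases Nat.eq_zero_or_pos m with hm | hm
  · subst hm; simp
  have hm' : (0 : ℝ) < m := Nat.cast_pos.2 hm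
  rw [mul_div_assoc]
  exact mul_le_of_le_one_right (Real.sqrt_nonneg _) ((div_le_one (by positivity)).2 (by linarith))

/-- **The balance identity** `a_m + L·(a_m/m) = √2`. [ours; elementary] -/
theorem amp_balance {L : ℝ} (hL : 0 ≤ L) {m : ℕ} (hm : 0 < m) : amp L m + L * (amp L m / m) = Real.sqrt 2 := by
  unfold amp
  have hm' : (0 : ℝ) < m := Nat.cast_pos.2 hm
  field_simp

/-- **The sup bound is exactly `4`** at the balanced amplitude. [ours; elementary] -/
theorem vortBound_amp {L : ℝ} (hL : 0 ≤ L) {m : ℕ} (hm : 0 < m) :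
    max 4 (2 * (|amp L m| + L * |amp L m / m|) ^ 2) = 4 := by
  have ha := amp_pos hL hm
  have hm' : (0 : ℝ) < m := Nat.cast_pos.2 hm
  rw [abs_of_pos ha, abs_of_pos (div_pos ha hm'), amp_balance hL hm, Real.sq_sqrt (by norm_num)]
  norm_num

include hε hε' in
/-- **The kill inequality at level `(ε, m)`.** If the K1-Q1 inequality holds with constant `C ≥ 0` for the
cellular field `u_{ε,m}` with majorant `M = 2` — `σ(u) ≤ C·2·ℰ(u)` — then
`4a_m²(ι² − 4ε) − K_m ≤ C(2 + 4a_m²ι² + K_m)`. [ours] -/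
theorem kill_ineq {m : ℕ} (hm : 0 < m) {C : ℝ} (hC : 0 ≤ C)
    (hle : enstrophyProduction (u (base hε hε') (envM hε hε') (wave hε hε' m (amp (envLip ε) m))) ≤
      C * 2 * torusEnstrophy (u (base hε hε') (envM hε hε') (wave hε hε' m (amp (envLip ε) m)))) :
    4 * amp (envLip ε) m ^ 2 * (envMsq (envM hε hε') ^ 2 - 4 * ε) - Kc ε m (amp (envLip ε) m) ≤
      C * (2 + 4 * amp (envLip ε) m ^ 2 * envMsq (envM hε hε') ^ 2 + Kc ε m (amp (envLip ε) m)) := by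
  set a := amp (envLip ε) m
  have hσ := integral_mainTerm_sub_le_production hε hε' m a
  have hlow := le_integral_mainTerm hε hε' a hm
  have hE := two_mul_torusEnstrophy_le hε hε' m a
  have hup := integral_mainTerm_le hε hε' m a
  have hs := slack_mem hε hε'
  have hμ : msqD (base hε hε') ≤ 1 := by rw [msqD_base_eq hε hε']; linarith [hs.1]
  have ha2 : 0 ≤ a ^ 2 := sq_nonneg a
  have h2E : 2 * torusEnstrophy (u (base hε hε') (envM hε hε') (wave hε hε' m a)) ≤
      2 + 4 * a ^ 2 * envMsq (envM hε hε') ^ 2 + Kc ε m a := by linarith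
  have hC2 := mul_le_mul_of_nonneg_left h2E hC
  have has : a ^ 2 * slack ε ≤ a ^ 2 * (4 * ε) := mul_le_mul_of_nonneg_left hs.2 ha2
  nlinarith [hC2, has, hσ, hlow, hle]

/-- `a_m² → 2`. [ours; elementary] -/
theorem tendsto_amp_sq {L : ℝ} : Tendsto (fun m : ℕ => amp L m ^ 2) atTop (𝓝 2) := by
  have h := (tendsto_natCast_div_add_atTop L).pow 2 |>.const_mul 2
  simp only [one_pow, mul_one] at h
  refine h.congr fun m => ?_
  unfold amp
  rw [mul_div_assoc, mul_pow, Real.sq_sqrt (by norm_num)]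

/-- `K_m → 0`. [ours; elementary] -/
theorem tendsto_Kc {L : ℝ} (hL : 0 ≤ L) (hLε : envLip ε = L) :
    Tendsto (fun m : ℕ => Kc ε m (amp L m)) atTop (𝓝 0) := by
  -- `|a_m/m| = √2/(m+L)` for `m ≥ 1`, `|a_m| ≤ √2`
  have h1 : Tendsto (fun m : ℕ => (m : ℝ) + L) atTop atTop :=
    tendsto_atTop_add_const_right _ L tendsto_natCast_atTop_atTop
  have h0 : Tendsto (fun m : ℕ => Real.sqrt 2 / ((m : ℝ) + L)) atTop (𝓝 0) := tendsto_const_nhds.div_atTop h1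
  have hb : Tendsto (fun m : ℕ => 4 * Real.sqrt 2 * L * (Real.sqrt 2 / ((m : ℝ) + L)) +
      2 * L ^ 2 * (Real.sqrt 2 / ((m : ℝ) + L)) ^ 2) atTop (𝓝 0) := by
    have := (h0.const_mul (4 * Real.sqrt 2 * L)).add ((h0.pow 2).const_mul (2 * L ^ 2))
    simpa using this
  refine squeeze_zero' (Filter.Eventually.of_forall fun m => Kc_nonneg (by rw [hLε]; exact hL) m _) ?_ hb
  filter_upwards [Filter.eventually_ge_atTop 1] with m hm
  have hm0 : 0 < m := hm
  have hm' : (0 : ℝ) < m := Nat.cast_pos.2 hm0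
  have ha := amp_pos hL hm0
  have hq : amp L m / m = Real.sqrt 2 / (m + L) := by
    unfold amp; field_simp
  rw [Kc, hLε, abs_of_pos ha, abs_of_pos (div_pos ha hm'), hq]
  have hle := amp_le hL m
  have hpos : 0 ≤ Real.sqrt 2 / (m + L) := by positivity
  nlinarith [mul_le_mul_of_nonneg_right hle (mul_nonneg (mul_nonneg (by norm_num : (0:ℝ) ≤ 4) hL) hpos)]

include hε hε' in
/-- **The limit `m → ∞` of the kill inequality**: `8ι² − 32ε ≤ C(2 + 8ι²)`. [ours] -/
theorem limit_ineq {C : ℝ} (hC : 0 ≤ C)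
    (hle : ∀ m : ℕ, 0 < m →
      enstrophyProduction (u (base hε hε') (envM hε hε') (wave hε hε' m (amp (envLip ε) m))) ≤
        C * 2 * torusEnstrophy (u (base hε hε') (envM hε hε') (wave hε hε' m (amp (envLip ε) m)))) :
    8 * envMsq (envM hε hε') ^ 2 - 32 * ε ≤ C * (2 + 8 * envMsq (envM hε hε') ^ 2) := by
  set ι := envMsq (envM hε hε')
  have hL := envLip_nonneg hε hε'
  have hA := tendsto_amp_sq (L := envLip ε)
  have hK := tendsto_Kc (ε := ε) hL rfl
  have hf : Tendsto (fun m : ℕ => 4 * amp (envLip ε) m ^ 2 * (ι ^ 2 - 4 * ε) - Kc ε m (amp (envLip ε) m))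
      atTop (𝓝 (4 * 2 * (ι ^ 2 - 4 * ε) - 0)) := ((hA.const_mul 4).mul_const _).sub hK
  have hg : Tendsto (fun m : ℕ => C * (2 + 4 * amp (envLip ε) m ^ 2 * ι ^ 2 + Kc ε m (amp (envLip ε) m)))
      atTop (𝓝 (C * (2 + 4 * 2 * ι ^ 2 + 0))) :=
    ((tendsto_const_nhds.add ((hA.const_mul 4).mul_const _)).add hK).const_mul C
  have hev : ∀ᶠ m : ℕ in atTop, 4 * amp (envLip ε) m ^ 2 * (ι ^ 2 - 4 * ε) - Kc ε m (amp (envLip ε) m) ≤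
      C * (2 + 4 * amp (envLip ε) m ^ 2 * ι ^ 2 + Kc ε m (amp (envLip ε) m)) := by
    filter_upwards [Filter.eventually_ge_atTop 1] with m hm
    exact kill_ineq hε hε' hm hC (hle m hm)
  have := le_of_tendsto_of_tendsto hf hg hev
  linarith

end Kill

/-- **The core contradiction.** No `C < ½` can bound the production of every cellular field
`u_{ε,m}` (`0 < ε ≤ 1/32`, `m ≥ 1`) by `C·2·ℰ`. [ours] -/
theorem false_of_forall_cell {C : ℝ} (hC0 : 0 ≤ C) (hC : C < 1 / 2)
    (hle : ∀ ε : ℝ, ∀ hε : 0 < ε, ∀ hε' : ε ≤ 1 / 32, ∀ m : ℕ, 0 < m →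
      enstrophyProduction (u (base hε hε') (envM hε hε') (wave hε hε' m (amp (envLip ε) m))) ≤
        C * 2 * torusEnstrophy (u (base hε hε') (envM hε hε') (wave hε hε' m (amp (envLip ε) m)))) :
    False := by
  set ε := min (1 / 32 : ℝ) ((1 / 2 - C) / 40) with hεdef
  have hε : 0 < ε := lt_min (by norm_num) (by linarith)
  have hε' : ε ≤ 1 / 32 := min_le_left _ _
  have hεC : ε ≤ (1 / 2 - C) / 40 := min_le_right _ _
  have key := limit_ineq hε hε' hC0 (hle ε hε hε')
  have hι := le_envMsq hε hε'
  have hι0 := half_sub_nonneg hε'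
  set ι := envMsq (envM hε hε')
  have h1 : (1 / 2 - 6 * ε) ^ 2 ≤ ι ^ 2 := pow_le_pow_left₀ hι0 hι 2
  have h2 : 8 * ι ^ 2 * (1 - C) ≤ 2 * C + 32 * ε := by linarith
  have h3 : 8 * (1 / 2 - 6 * ε) ^ 2 * (1 - C) ≤ 2 * C + 32 * ε :=
    le_trans (mul_le_mul_of_nonneg_right (mul_le_mul_of_nonneg_left h1 (by norm_num)) (by linarith)) h2
  nlinarith [mul_nonneg hε.le (sub_nonneg.2 hC.le), sq_nonneg ε, mul_nonneg (sq_nonneg ε) (sub_nonneg.2 hC.le)]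

/-- **K1-Q1 lower side: no constant below `½` works** — `¬ StretchingSupBound C` for every `C < ½`
(cellular fields: crossed shears `(S_ε(x₁), −S_ε(x₀))` plus envelope-confined waves aligned with the
stretching direction of each strain cell; bank `K1Q1-HALF.md` Thm 1). Search for candidate a priori
estimates; no regularity claim. [ours] -/
theorem not_stretchingSupBound_of_lt_half {C : ℝ} (hC : C < 1 / 2) : ¬ StretchingSupBound (d := Fin 3) C := by
  intro hS
  have hS' : StretchingSupBound (d := Fin 3) (max C 0) := hS.mono (le_max_left _ _)
  refine false_of_forall_cell (le_max_right C 0) (max_lt hC (by norm_num)) fun ε hε hε' m hm => ?_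
  have hL := envLip_nonneg hε hε'
  refine hS' (Fintype.card_fin 3) _ (isSmooth_u _ _ _) (isDivFree_u _ _ _) 2 (by norm_num) fun x => ?_
  have h := torusVorticitySqAt_cell_le hε hε' m (amp (envLip ε) m) x
  rw [vortBound_amp hL hm] at h
  linarith

/-- **The 2½-D row fails below `½` as well**: `¬ StretchingSupBoundPlanar C` for `C < ½` (the cellular
fields are `2½`-dimensional, `∂₂u = 0`). With the tree's `stretchingSupBoundPlanar_half` the planar
class constant is EXACTLY `½` (bank `K1Q1-HALF.md` Thm 1: `C_{2.5D} = ½`). Search for candidate a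
priori estimates; no regularity claim. [ours] -/
theorem not_stretchingSupBoundPlanar_of_lt_half {C : ℝ} (hC : C < 1 / 2) :
    ¬ StretchingSupBoundPlanar (d := Fin 3) C := by
  intro hS
  have hS' : StretchingSupBoundPlanar (d := Fin 3) (max C 0) := hS.mono (le_max_left _ _)
  refine false_of_forall_cell (le_max_right C 0) (max_lt hC (by norm_num)) fun ε hε hε' m hm => ?_
  have hL := envLip_nonneg hε hε'
  refine hS' (Fintype.card_fin 3) _ (isSmooth_u _ _ _) (isDivFree_u _ _ _)
    ⟨2, fun x => by rw [partialDeriv_two_u]; rfl⟩ 2 (by norm_num) fun x => ?_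
  have h := torusVorticitySqAt_cell_le hε hε' m (amp (envLip ε) m) x
  rw [vortBound_amp hL hm] at h
  linarith

/-- **`C_{2.5D} = ½` exactly**: the planar K1-Q1 row holds with constant `C` iff `½ ≤ C`. Search for
candidate a priori estimates; no regularity claim. [ours] -/
theorem stretchingSupBoundPlanar_iff {C : ℝ} : StretchingSupBoundPlanar (d := Fin 3) C ↔ 1 / 2 ≤ C :=
  ⟨fun h => not_lt.1 fun hC => not_stretchingSupBoundPlanar_of_lt_half hC h,
    fun h => stretchingSupBoundPlanar_half.mono h⟩

/-- **`½ ≤ C⋆`: the sharp static sup-stretching constant of K1-Q1 is at least `½`** (was `√6/24`,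
`√(71−17√17)/4 ≈ 0.238` in the tree). With `stretchingSupConst_le_holder`: `½ ≤ C⋆ ≤ 2/√3`, ratio `4/√3 ≈ 2.31`.
Whether genuinely three-dimensional fields beat `½` is the open part of K1-Q1 at kernel level (the bank's
hand Theorem 3 gives `(2+√5)/8`). Search for candidate a priori estimates; no regularity claim. [ours] -/
theorem half_le_stretchingSupConst : 1 / 2 ≤ stretchingSupConst (d := Fin 3) :=
  le_of_forall_lt_imp_le_of_dense fun _ hC => le_stretchingSupConst (not_stretchingSupBound_of_lt_half hC)

/-- **`C_{2.5D} = ½` in the class-constant vocabulary** (`stretchingSupConstOn IsTwoHalfD`, dictionary seat's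
`StretchingClassConst`): the optimal constant of the K1-Q1 row on 2½-dimensional fields is exactly `½`
(bank `K1Q1-HALF.md` Thm 1, now a kernel theorem). Search for candidate a priori estimates; no regularity
claim. [ours] -/
theorem stretchingSupConstOn_isTwoHalfD_eq_half : stretchingSupConstOn (IsTwoHalfD (d := Fin 3)) = 1 / 2 :=
  le_antisymm stretchingSupConstOn_isTwoHalfD_le_half
    (le_stretchingSupConstOn_of_forall_lt fun _ hC h =>
      not_stretchingSupBoundPlanar_of_lt_half hC (stretchingSupBoundOn_isTwoHalfD_iff.mp h))

/-- **The K1-Q1 kernel window after this file: `½ ≤ C⋆ ≤ 2/√3`.** Search for candidate a priori estimates;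
no regularity claim. [ours] -/
theorem stretchingSupConst_window :
    1 / 2 ≤ stretchingSupConst (d := Fin 3) ∧ stretchingSupConst (d := Fin 3) ≤ 2 / Real.sqrt 3 :=
  ⟨half_le_stretchingSupConst, stretchingSupConst_le_holder⟩

end CellularStretching

end Summit.NavierStokesRegularity.FunctionalMining

end
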